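import Summits.QuantumAdvantage.QuantumAdvantage.Theorems.CharDialTransferDialI
import Literature.Combinatorics.Hypergraph.RamseyTheorem
import HarnessLib

/-!
# TransferDial J — kernel of `RainbowBound`, IV: iterated hypergraph Ramsey and ★ `rainbowBound : RainbowBound`

`col f T W` = the indicator of the code set of `Φ(W)` (a finite colour); `exists_hom`: by the tree's finite hypergraph Ramsey theorem
(`Literature.Combinatorics.Hypergraph.exists_ramsey_finite`), iterated over the levels `ℓ = T, T−1, …, 2`, every large coordinate set
contains a `T`-subset `Y'` all of whose `ℓ`-subsets have the same `Φ`, `2 ≤ ℓ ≤ T` (`HomAt`).  ★ `rainbowBound`: with `T = 5((R·R)^R+1)+1`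
the levels `Ψ ℓ = Φ(any ℓ-subset of Y')` form a thin homogeneous restriction system (part I: `resN_psi`, `reads_psi`, `card_PhiF_le`),
so by part H every `g ∈ Ψ 2` is symmetric, i.e. any two coordinates of `Y'` are exchangeable for `f` (`rk_pair_left/right`) — a rainbow
set therefore has fewer than the Ramsey number of elements.  Corollaries (ns `…Theorems.TransferDial`): ★★ `partnersTwoOdd_of_sliceFew :
SliceFewTwoOdd → PartnersTwoOdd` (part F's carving with piece C discharged) and ★★★ `structureLaw_iff_sliceFew_of_PF : FieldCorePerPrime →
(StructureLawTwoOdd ↔ SliceFewTwoOdd)` (parts E, F): modulo the field core PF (g22 paper), piece B of the CharDial residual IS the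
slice-count statement «at 𝔽_p-degree ≤ 2p − 3 every bipartition has ≤ R(p) distinct rows».

Tree twin, part J of the decomp-qadv lens-6 g23 addendum (`g23/RainbowKernel.lean` §Model from the colouring on, bodies verbatim,
namespace `…Theses.SliceDial.Model` ↦ `…Theorems.TransferDial.Model`; the two corollaries are new one-liners).  0 sorry; no `instance`,
no `notation`, no `native_decide`.
-/

set_option autoImplicit false
set_option linter.dupNamespace false

namespace Summit.QuantumAdvantage.QuantumAdvantage.Theorems.TransferDial.Model

open Classical Finset
open Summit.QuantumAdvantage.QuantumAdvantage.Theorems.TransferDial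
open Summit.QuantumAdvantage.QuantumAdvantage.Theorems.TransferDial.HomSys

variable {m : ℕ}

/-! ## iterated Ramsey: a `T`-set all of whose `ℓ`-subsets carry the same `Φ`, `2 ≤ ℓ ≤ T` -/

/-- the level colour of a coordinate set: the indicator of the code set of `Φ(W)`. -/
noncomputable def col (f : (Fin m → Bool) → Bool) (T : ℕ) (W : Finset (Fin m)) :
    ((Fin T → Bool) → Bool) → Bool :=
  fun h => decide (∃ b, h = fun z => psi f W b (ext T z))

/-- Equal level colours ⟹ equal `Φ` (for coordinate sets of size `≤ T`). -/
theorem Phi_iff_of_col_eq (f : (Fin m → Bool) → Bool) (T : ℕ) {W W' : Finset (Fin m)} (hW : W.card ≤ T)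
    (hW' : W'.card ≤ T) (h : col f T W = col f T W') (ψ : (ℕ → Bool) → Bool) :
    Phi f W ψ ↔ Phi f W' ψ := by
  have key : ∀ {W W' : Finset (Fin m)}, W.card ≤ T → W'.card ≤ T → col f T W = col f T W' →
      ∀ b, ∃ b', psi f W b = psi f W' b' := by
    intro W W' hW hW' h b
    have h1 : col f T W (fun z => psi f W b (ext T z)) = true := by
      unfold col; rw [decide_eq_true_iff]; exact ⟨b, rfl⟩
    rw [h] at h1
    unfold col at h1
    rw [decide_eq_true_iff] at h1
    obtain ⟨b', hb'⟩ := h1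
    exact ⟨b', psi_eq_of_code_eq f T hW hW' b b' hb'⟩
  constructor
  · rintro ⟨b, rfl⟩
    obtain ⟨b', e⟩ := key hW hW' h b
    exact ⟨b', e⟩
  · rintro ⟨b', rfl⟩
    obtain ⟨b, e⟩ := key hW' hW h.symm b'
    exact ⟨b, e⟩

/-- homogeneity of `Y'` at the levels `j ≤ ℓ ≤ T`. -/
def HomAt (f : (Fin m → Bool) → Bool) (T : ℕ) (Y' : Finset (Fin m)) (j : ℕ) : Prop :=
  ∀ ℓ, j ≤ ℓ → ℓ ≤ T → ∀ W₁ ∈ Y'.powersetCard ℓ, ∀ W₂ ∈ Y'.powersetCard ℓ, col f T W₁ = col f T W₂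

/-- Iterated hypergraph Ramsey: a large coordinate set contains a `T`-subset homogeneous at all levels `T + 1 - i ≤ ℓ ≤ T`. -/
theorem exists_hom (T : ℕ) : ∀ i, i ≤ T + 1 → ∃ N : ℕ, ∀ (m : ℕ) (f : (Fin m → Bool) → Bool)
    (Y : Finset (Fin m)), N ≤ Y.card → ∃ Y' ⊆ Y, Y'.card = T ∧ HomAt f T Y' (T + 1 - i) := by
  intro i
  induction i with
  | zero =>
      intro _
      refine ⟨T, fun m f Y hY => ?_⟩
      obtain ⟨Y', hY', hc⟩ := exists_subset_card_eq hY
      exact ⟨Y', hY', hc, fun ℓ h1 h2 => by omega⟩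
  | succ i ih =>
      intro hi
      obtain ⟨N₁, hN₁⟩ := ih (by omega)
      obtain ⟨N, hN⟩ : ∃ N : ℕ, ∀ {α : Type} (X : Finset α), N ≤ X.card →
          ∀ c : Finset α → (((Fin T → Bool) → Bool) → Bool),
          ∃ Y ⊆ X, Y.card = N₁ ∧ ∃ e : ((Fin T → Bool) → Bool) → Bool, ∀ Z ∈ Y.powersetCard (T - i), c Z = e :=
        Literature.Combinatorics.Hypergraph.exists_ramsey_finite (T - i) N₁ (((Fin T → Bool) → Bool) → Bool)
      refine ⟨N, fun m f Y hY => ?_⟩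
      obtain ⟨Yh, hYh, hcard, e, he⟩ := hN Y hY (col f T)
      obtain ⟨Y', hY', hc', hhom⟩ := hN₁ m f Yh (by rw [hcard])
      refine ⟨Y', hY'.trans hYh, hc', ?_⟩
      intro ℓ h1 h2 W₁ hW₁ W₂ hW₂
      by_cases hℓ : T + 1 - i ≤ ℓ
      · exact hhom ℓ hℓ h2 W₁ hW₁ W₂ hW₂
      · have hℓ' : ℓ = T - i := by omega
        subst hℓ'
        rw [he W₁ (powersetCard_mono hY' hW₁), he W₂ (powersetCard_mono hY' hW₂)]

/-! ## ★ RainbowBound -/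

/-- ★ K3: `RainbowBound` (piece C of the SliceDial addendum) holds: a Boolean function all of whose
bipartitions have `≤ R` distinct rows has no rainbow (pairwise non-exchangeable) coordinate set larger than an
iterated hypergraph-Ramsey number. -/
theorem rainbowBound : RainbowBound := by
  intro R
  obtain ⟨N, hN⟩ := exists_hom (5 * ((R * R) ^ R + 1) + 1) (5 * ((R * R) ^ R + 1)) (by omega)
  refine ⟨N, fun m f hthin Y hY => ?_⟩
  by_contra hlt
  obtain ⟨Y', hY'Y, hcard, hhom⟩ := hN m f Y (by omega)
  -- abbreviations
  have hA : (R * R) ^ R < (R * R) ^ R + 1 := by omega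
  have hhom2 : ∀ ℓ, 2 ≤ ℓ → ℓ ≤ 5 * ((R * R) ^ R + 1) + 1 → ∀ W₁, W₁ ⊆ Y' → W₁.card = ℓ →
      ∀ W₂, W₂ ⊆ Y' → W₂.card = ℓ → ∀ ψ, Phi f W₁ ψ ↔ Phi f W₂ ψ := by
    intro ℓ h1 h2 W₁ s1 c1 W₂ s2 c2 ψ
    apply Phi_iff_of_col_eq f (5 * ((R * R) ^ R + 1) + 1) (by omega) (by omega)
    exact hhom ℓ (by omega) h2 W₁ (mem_powersetCard.2 ⟨s1, c1⟩) W₂ (mem_powersetCard.2 ⟨s2, c2⟩)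
  -- generalize T
  generalize hT : 5 * ((R * R) ^ R + 1) + 1 = T at hcard hhom2
  clear hhom
  have hT5 : 5 * ((R * R) ^ R + 1) + 1 ≤ T := by omega
  have hT3 : 3 ≤ T := by omega
  -- the restriction system
  let Ψ : ℕ → ((ℕ → Bool) → Bool) → Prop := fun ℓ ψ => ∃ W, W ⊆ Y' ∧ W.card = ℓ ∧ Phi f W ψ
  obtain ⟨W₁, hW₁, hcW₁⟩ := exists_subset_card_eq (show T - 1 ≤ Y'.card by omega)
  have hΦt : ∀ ψ, Ψ T ψ ↔ ψ ∈ PhiF f Y' := by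
    intro ψ
    constructor
    · rintro ⟨W, hW, hc, hphi⟩
      have : W = Y' := eq_of_subset_of_card_le hW (by rw [hc, hcard])
      subst this
      exact (mem_PhiF f _ ψ).2 hphi
    · intro h; exact ⟨Y', subset_rfl, hcard, (mem_PhiF f _ ψ).1 h⟩
  have hΦt1 : ∀ ψ, Ψ (T - 1) ψ ↔ ψ ∈ PhiF f W₁ := by
    intro ψ
    constructor
    · rintro ⟨W, hW, hc, hphi⟩
      exact (mem_PhiF f _ ψ).2 ((hhom2 (T - 1) (by omega) (by omega) W hW hc W₁ hW₁ hcW₁ ψ).1 hphi)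
    · intro h; exact ⟨W₁, hW₁, hcW₁, (mem_PhiF f _ ψ).1 h⟩
  have hct : (PhiF f Y').card ≤ R := (card_PhiF_le f Y').trans (hthin _)
  have hct1 : (PhiF f W₁).card ≤ R := (card_PhiF_le f W₁).trans (hthin _)
  have hclosed : ∀ ψ, Ψ T ψ → ∀ s, s < T → ∀ c, Ψ (T - 1) (resN s c ψ) := by
    rintro ψ ⟨W, hW, hc, ⟨b, rfl⟩⟩ s hs c
    obtain ⟨w, hw, hrk⟩ := exists_rk_eq W s (by omega)
    have e := resN_psi f W b hw c
    rw [hrk] at e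
    rw [e]
    exact ⟨W.erase w, (erase_subset _ _).trans hW, by rw [card_erase_of_mem hw, hc], _, rfl⟩
  have hreads : ∀ ℓ ψ, Ψ ℓ ψ → Reads ℓ ψ := by
    rintro ℓ ψ ⟨W, _, hc, ⟨b, rfl⟩⟩
    rw [← hc]
    exact reads_psi f W b
  have hsurj : ∀ ℓ, 2 ≤ ℓ → ℓ < T → ∀ ψ', Ψ ℓ ψ' → ∀ p, p ≤ ℓ →
      ∃ ψ c, Ψ (ℓ + 1) ψ ∧ resN p c ψ = ψ' := by
    rintro ℓ h1 h2 ψ' ⟨W', hW', hc', hphi'⟩ p hp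
    obtain ⟨W, hW, hcW⟩ := exists_subset_card_eq (show ℓ + 1 ≤ Y'.card by omega)
    obtain ⟨w, hw, hrk⟩ := exists_rk_eq W p (by omega)
    have hcE : (W.erase w).card = ℓ := by rw [card_erase_of_mem hw, hcW]; simp
    have hphi : Phi f (W.erase w) ψ' :=
      (hhom2 ℓ h1 (by omega) W' hW' hc' (W.erase w) ((erase_subset _ _).trans hW) hcE ψ').1 hphi'
    obtain ⟨b', rfl⟩ := hphi
    refine ⟨psi f W b', b' w, ⟨W, hW, hcW, b', rfl⟩, ?_⟩
    have e := resN_psi f W b' hw (b' w)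
    rw [hrk, Function.update_eq_self] at e
    exact e
  have key := level_two_symmetric_of_thin (V := Bool) Ψ R ((R * R) ^ R + 1) T hA hT5 (PhiF f Y') (PhiF f W₁)
    hΦt hΦt1 hct hct1 hclosed hreads
    (fun ℓ h1 h2 ψ' hψ' => hsurj ℓ h1 h2 ψ' hψ' 0 (by omega))
    (fun ℓ h1 h2 ψ' hψ' => hsurj ℓ h1 h2 ψ' hψ' ℓ le_rfl)
  -- two coordinates of Y' are exchangeable: contradiction with rainbowness
  obtain ⟨i, j, hi, hj, hij⟩ := one_lt_card_iff.1 (show 1 < Y'.card by omega)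
  have main : ∀ i j : Fin m, i ∈ Y' → j ∈ Y' → i < j → False := by
    intro i j hi hj hlt
    apply hY i (hY'Y hi) j (hY'Y hj) (ne_of_lt hlt)
    intro u
    have hsub : ({i, j} : Finset (Fin m)) ⊆ Y' := insert_subset hi (singleton_subset_iff.2 hj)
    have hg : Ψ 2 (psi f {i, j} u) := ⟨{i, j}, hsub, card_pair (ne_of_lt hlt), u, rfl⟩
    have hk := key _ hg (fun k => if k = 0 then u i else u j)
    have e1 : fill {i, j} u (fun k => if k = 0 then u i else u j) = u := by
      funext k
      unfold fill
      by_cases hk : k ∈ ({i, j} : Finset (Fin m))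
      · rw [if_pos hk]
        simp only [mem_insert, mem_singleton] at hk
        rcases hk with rfl | rfl
        · rw [rk_pair_left hlt]; simp
        · rw [rk_pair_right hlt]; simp
      · rw [if_neg hk]
    have e2 : fill {i, j} u (swN 0 1 (fun k => if k = 0 then u i else u j)) = u ∘ Equiv.swap i j := by
      funext k
      unfold fill swN
      by_cases hk : k ∈ ({i, j} : Finset (Fin m))
      · rw [if_pos hk]
        simp only [mem_insert, mem_singleton] at hk
        rcases hk with rfl | rfl
        · rw [rk_pair_left hlt]
          simp [Equiv.swap_apply_left]
        · rw [rk_pair_right hlt]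
          simp [Equiv.swap_apply_right]
      · rw [if_neg hk]
        simp only [mem_insert, mem_singleton, not_or] at hk
        simp only [Function.comp_apply]
        rw [Equiv.swap_apply_of_ne_of_ne hk.1 hk.2]
    unfold psi at hk
    rw [e1, e2] at hk
    exact hk
  rcases lt_or_gt_of_ne hij with hlt | hgt
  · exact main i j hi hj hlt
  · exact main j i hj hi hgt

end Summit.QuantumAdvantage.QuantumAdvantage.Theorems.TransferDial.Model

/--
info: 'Summit.QuantumAdvantage.QuantumAdvantage.Theorems.TransferDial.Model.rainbowBound' depends on axioms: [propext,
 Classical.choice,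
 Quot.sound]
-/
#guard_msgs in #print axioms Summit.QuantumAdvantage.QuantumAdvantage.Theorems.TransferDial.Model.rainbowBound

namespace Summit.QuantumAdvantage.QuantumAdvantage.Theorems.TransferDial

/-- ★★ Part F's carving with piece C discharged: `PartnersTwoOdd ⟸ SliceFewTwoOdd` alone. -/
theorem partnersTwoOdd_of_sliceFew (hS : SliceFewTwoOdd) : PartnersTwoOdd :=
  partners_of_sliceFew_rainbow hS Model.rainbowBound

/-- ★★★ Modulo the field core PF (parts B, E): piece B of the CharDial residual ⟺ the slice-count statement `SliceFewTwoOdd`. -/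
theorem structureLaw_iff_sliceFew_of_PF (hPF : FieldCorePerPrime) : StructureLawTwoOdd ↔ SliceFewTwoOdd :=
  ⟨sliceFew_of_structureLaw, fun hS => closes_of_PF hPF (partnersTwoOdd_of_sliceFew hS)⟩

/-- info: 'Summit.QuantumAdvantage.QuantumAdvantage.Theorems.TransferDial.structureLaw_iff_sliceFew_of_PF' depends on axioms: [propext,
 Classical.choice,
 Quot.sound] -/
#guard_msgs in #print axioms structureLaw_iff_sliceFew_of_PF

end Summit.QuantumAdvantage.QuantumAdvantage.Theorems.TransferDial
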